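/-
COR-CM (cell pub-hodgecm2, stage 2 of the Hodge ladder) — count-neutral KERNEL COMBINATORICS «the binary tetrahedral group SL(2,3)», part IIIb: the DATUM from a non-normal Sylow 3 and the ORDER-24 /
ORDER-8p DICHOTOMIES (seat prover-pub-hodgecm2-b23-g53-0, binder prover b23, gen 53; claim HOME/INBOX.md l.24246, NAME ASK l.24300, lead ACK
l.24306).  Theorems only, on parts I–II, this seatʼs `Census/SylowTransfer{ShearedElements,EightPrimeAll}.lean` and gen 51ʼs parts VII/XI BY NAME; `decide`
only on closed numerals, no certificate, no named fact, no `sorry`; `Interfaces.lean` (C1), every E term, B01, `Transposition/*`, `PortJoin/*`, `D2Bridge/*` untouched.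
HONEST FRAMING: `HC_CM` is NOT proved, here or anywhere in the tree; nothing here is a period, a count of record or a headline.
-/
import Summits.HodgeConjecture.CorCM.Census.BinaryTetrahedralFloor
import Summits.HodgeConjecture.CorCM.Census.BinaryTetrahedralCounting

/-!
# The binary tetrahedral group, IIIb: every group of order `8p` has `μ = φ₂` or carries an `SL(2,3)` datum

* §1 **The datum** (`nonempty_datum`): `|G| = 24`, `c` a central involution, `z` of order `3` with `⟨z⟩` not normal and a NON-abelian Sylow
  `2`-subgroup `P` (normal by part IIIa): `y ∈ P` with `y² = c` (gen 51 XI) is moved by `z` off `⟨y⟩` (else `z` would centralise `P` and be central),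
  `i := y`, `j := z y z⁻¹` satisfy the quaternion relations (part XIII), and `z j z⁻¹ ∈ {j·y, y·j}` — giving the datum `(y, j y, z⁻¹)` or `(y, j, z)`.
* §2 **THE DICHOTOMIES**: **every group of order `24` and every central involution: `μ(G, c) = φ₂(G, c)` or `G` carries a binary tetrahedral
  datum** (`isLeast_or_nonempty_datum_of_card_eq_twentyfour`); **every group of order `8p`, `p` any odd prime: the same, with `p = 3` in the datum
  branch** (`isLeast_or_nonempty_datum_of_card_eq_eight_mul_prime`, part XIV for `p ≥ 5`); in the datum branch the floor `μ ≥ β − 2 = φ₂` of part II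
  holds (`isLeast_or_floor_of_card_eq_eight_mul_prime`) and the row (`β = 176`, `φ₂ = 174`) is the ONE open row of order `8p`.
All [folklore] bookkeeping over [Pohlmann1968, Thm 1] in the reading of [Milne1999, Prop. 2.1].

## References
* [Pohlmann1968] H. Pohlmann, Algebraic cycles on abelian varieties of complex multiplication type, Ann. of Math. 88 (1968), Thm 1.
* [Milne1999] J. S. Milne, Lefschetz motives and the Tate conjecture, Compositio Math. 117 (1999), Prop. 2.1, p. 54.
-/

namespace Summit.HodgeConjecture.CorCM.Census.BinaryTetrahedral

open Finset
open Summit.HodgeConjecture.CorCM.Prior.AllgGroup.RfwfAllgGroup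
open Summit.HodgeConjecture.CorCM.Census.BlockParity
open Summit.HodgeConjecture.CorCM.Census.Coinvariant
open Summit.HodgeConjecture.CorCM.Census.TypeStabiliser
open Summit.HodgeConjecture.CorCM.Census.SylowTransfer

noncomputable section

variable {G : Type*} [Group G] [Fintype G] [DecidableEq G]

/-! ## §1 The binary tetrahedral datum -/

/-- **THE BINARY TETRAHEDRAL DATUM**: `|G| = 24`, `c` a central involution, `z` of order `3` with `⟨z⟩` not normal, and a NON-abelian Sylow
`2`-subgroup `P` ⟹ `G` carries a `BinaryTetrahedral.Datum G c` with `Q = P`.  Construction: `y ∈ P` with `y² = c` (gen 51 XI); `j := z y z⁻¹`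
lies in `P` (§1) but not in `⟨y⟩` (`j = y⁻¹` is excluded by `mul_self_eq_one_of_orderOf_three_of_conj_eq_inv`, `j = y` by the two lemmas
above and the non-normality of `⟨z⟩`), so `j` inverts `y` (part XIII); `k := z j z⁻¹ ∈ P` is neither in `⟨y⟩` nor in `{j, j⁻¹}`, hence
`k = j y` — datum `(y, j y, z⁻¹)` — or `k = j y³ = y j` — datum `(y, j, z)`. [folklore] -/
theorem nonempty_datum (c : G) (hG : Fintype.card G = 24) {z : G} (hz : orderOf z = 3)
    (hzn : ∃ w : G, w * z * w⁻¹ ∉ Subgroup.zpowers z) (hc2 : c * c = 1) (hc1 : c ≠ 1) (hcen : ∀ w : G, w * c = c * w)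
    (P : Sylow 2 G) (hnc : ¬ ∀ a ∈ (P : Subgroup G), ∀ b ∈ (P : Subgroup G), a * b = b * a) :
    ∃ D : Datum G c, D.Q = (P : Subgroup G) := by
  classical
  haveI : Fact (Nat.Prime 2) := ⟨Nat.prime_two⟩
  obtain ⟨hP8, -⟩ := card_sylow_eq_eight P (m := 3) (by rw [hG]) (by decide)
  have hcP : c ∈ (P : Subgroup G) := TypeStabiliser.mem_sylow_of_central c hc2 hcen P
  have hzP : ∀ q ∈ (P : Subgroup G), z * q * z⁻¹ ∈ (P : Subgroup G) := fun q hq =>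
    conj_mem_sylow_two c hG hz hzn hc2 hc1 hcen P z hq
  have hz3 : z ^ 3 = 1 := by rw [← hz, pow_orderOf_eq_one]
  have hzz : z * z = z⁻¹ := eq_inv_of_mul_eq_one_left (by rw [← pow_two, ← pow_succ, hz3])
  have hcardG : Nat.card G = 24 := by rw [Nat.card_eq_fintype_card, hG]
  have hord_conj : ∀ g : G, orderOf (z * g * z⁻¹) = orderOf g := fun g => by rw [← MulAut.conj_apply, MulEquiv.orderOf_eq]
  -- `y² = c`, `ord y = 4`
  obtain ⟨y, hyP, hyy⟩ := exists_sq_of_card_eight_not_comm c hP8 hnc hcP hc2 hc1 hcen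
  have hy2 : y ^ 2 = c := by rw [pow_two, hyy]
  have hordy : orderOf y = 4 := by
    have h := orderOf_eq_prime_pow (p := 2) (n := 1) (x := y) (by rw [pow_one, hy2]; exact hc1)
      (by rw [show 2 ^ (1 + 1) = 2 * 2 by norm_num, pow_mul, hy2, pow_two, hc2])
    simpa using h
  have hy4 : y ^ 4 = 1 := by rw [← hordy, pow_orderOf_eq_one]
  -- `z` neither centralises nor inverts `y`
  have hzy : z * y * z⁻¹ ≠ y := fun h => by
    obtain ⟨w, hw⟩ := hzn
    have hcomm := commute_of_centralises_card_eight hG hP8 hz (conj_eq_self_of_centralises_orderOf_four hP8 hz hyP hordy hzP h) w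
    exact hw (by rw [hcomm, mul_inv_cancel_right]; exact Subgroup.mem_zpowers z)
  have hzy' : z * y * z⁻¹ ≠ y⁻¹ := fun h => by
    have h1 := mul_self_eq_one_of_orderOf_three_of_conj_eq_inv hz h
    rw [hyy] at h1
    exact hc1 h1
  -- `j := z y z⁻¹ ∈ P ∖ ⟨y⟩` inverts `y`
  set j := z * y * z⁻¹ with hj
  have hjP : j ∈ (P : Subgroup G) := hzP y hyP
  have hjj : j * j = c := by
    rw [hj, show z * y * z⁻¹ * (z * y * z⁻¹) = z * (y * y) * z⁻¹ by group, hyy, hcen z, mul_inv_cancel_right]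
  have hordj : orderOf j = 4 := by rw [hj, hord_conj, hordy]
  have hjy : j ∉ Subgroup.zpowers y := fun h => by
    rcases eq_or_eq_inv_of_orderOf_four hordy h hordj with h | h
    · exact hzy h
    · exact hzy' h
  obtain ⟨hji, -⟩ := conj_eq_inv_and_sq_of_card_eight_not_comm hP8 hnc hyP hjP hordy hjy
  obtain ⟨-, -, hsplit⟩ := conj_mem_zpowers_of_card_eight hP8 hyP hjP hordy hjy
  -- `y j = j y⁻¹ = j y³`
  have hyinv : y⁻¹ = y ^ 3 := inv_eq_of_mul_eq_one_right (by rw [← pow_succ', hy4])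
  have hyj : y * j = j * y ^ 3 := by
    rw [← hyinv]
    calc y * j = (j * y * j⁻¹)⁻¹ * j := by rw [hji, inv_inv]
      _ = j * y⁻¹ := by group
  -- `k := z j z⁻¹ = z⁻¹ y z ∈ P`
  have hkP : z * j * z⁻¹ ∈ (P : Subgroup G) := hzP j hjP
  have hordk : orderOf (z * j * z⁻¹) = 4 := by rw [hord_conj, hordj]
  have hkeq : z * j * z⁻¹ = z⁻¹ * y * z := by
    calc z * j * z⁻¹ = (z * z) * y * (z * z)⁻¹ := by rw [hj]; group
      _ = z⁻¹ * y * z := by rw [hzz, inv_inv]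
  have hzjz : z⁻¹ * j * z = y := by rw [hj]; group
  -- `k ∉ {y, y⁻¹, j, j⁻¹}`
  have hky : z * j * z⁻¹ ≠ y := fun h => hzy (by
    rw [hkeq] at h
    calc z * y * z⁻¹ = z * (z⁻¹ * y * z) * z⁻¹ := by rw [h]
      _ = y := by group)
  have hky' : z * j * z⁻¹ ≠ y⁻¹ := fun h => by
    rw [hkeq] at h
    have h1 := mul_self_eq_one_of_orderOf_three_of_conj_eq_inv (z := z⁻¹) (y := y) (by rw [orderOf_inv, hz]) (by rw [inv_inv]; exact h)
    rw [hyy] at h1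
    exact hc1 h1
  have hkj : z * j * z⁻¹ ≠ j := fun h => hzy (by rw [hj] at h; exact mul_left_cancel (mul_right_cancel h))
  have hkj' : z * j * z⁻¹ ≠ j⁻¹ := fun h => by
    have h1 := mul_self_eq_one_of_orderOf_three_of_conj_eq_inv hz h
    rw [hjj] at h1
    exact hc1 h1
  -- hence `k = j y` or `k = j y³`
  have hksplit : z * j * z⁻¹ = j * y ∨ z * j * z⁻¹ = j * y ^ 3 := by
    rcases hsplit _ hkP with h | h
    · exfalso
      rcases eq_or_eq_inv_of_orderOf_four hordy h hordk with h | h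
      · exact hky h
      · exact hky' h
    · obtain ⟨m, hm4, hm⟩ := IndexTwoCyclic.exists_pow_eq_of_mem_zpowers h
      rw [hordy] at hm4
      have hk : z * j * z⁻¹ = j * y ^ m := by rw [hm, mul_inv_cancel_left]
      interval_cases m
      · exact absurd (by rw [hk, pow_zero, mul_one]) hkj
      · exact Or.inl (by rw [hk, pow_one])
      · exfalso
        apply hkj'
        rw [hk, hy2, eq_inv_iff_mul_eq_one, mul_assoc, ← hcen j, ← mul_assoc, hjj, hc2]
      · exact Or.inr hk
  rcases hksplit with hk | hk
  · -- `i ↦ j y ↦ j ↦ i` under `z⁻¹`: the datum `(y, j y, z⁻¹)`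
    refine ⟨{ i := y, j := j * y, a := z⁻¹, Q := (P : Subgroup G), hord_i := hordy, hii := hyy, hjj := ?_, hji := ?_, hj := ?_,
              hiQ := hyP, hjQ := mul_mem hjP hyP, hQ := hP8, hord_a := by rw [orderOf_inv, hz], hai := ?_, haj := ?_,
              hcard := hcardG }, rfl⟩
    · calc j * y * (j * y) = (j * y * j⁻¹) * (j * j) * y := by group
        _ = y⁻¹ * c * y := by rw [hji, hjj]
        _ = c := by rw [mul_assoc, ← hcen y, inv_mul_cancel_left]
    · calc j * y * y * (j * y)⁻¹ = j * y * j⁻¹ := by group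
        _ = y⁻¹ := hji
    · intro h
      apply hjy
      have h1 := mul_mem h (inv_mem (Subgroup.mem_zpowers y))
      rwa [mul_inv_cancel_right] at h1
    · rw [inv_inv, ← hkeq, hk]
    · rw [inv_inv]
      calc z⁻¹ * (j * y) * z = (z⁻¹ * j * z) * (z⁻¹ * y * z) := by group
        _ = y * (j * y) := by rw [hzjz, ← hkeq, hk]
  · -- `i ↦ j ↦ y j ↦ i` under `z`: the datum `(y, j, z)`
    refine ⟨{ i := y, j := j, a := z, Q := (P : Subgroup G), hord_i := hordy, hii := hyy, hjj := hjj, hji := hji, hj := hjy,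
              hiQ := hyP, hjQ := hjP, hQ := hP8, hord_a := hz, hai := rfl, haj := ?_, hcard := hcardG }, rfl⟩
    rw [hk, hyj]

/-! ## §2 The dichotomies -/

/-- **THE ORDER-24 DICHOTOMY: every finite group of order `24` and every central involution `c` has `μ(G, c) = φ₂(G, c)`, or `G` carries a
binary tetrahedral datum** (`G ≅ SL(2,3)`, `c = −1`).  By Cauchy an element `z` of order `3` exists; `⟨z⟩` normal ⟹ part XIII; else the Sylow
`2`-subgroup is normal (§1): abelian ⟹ gen 51 VII, non-abelian ⟹ the datum (§2). [folklore] -/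
theorem isLeast_or_nonempty_datum_of_card_eq_twentyfour (c : G) (hG : Fintype.card G = 24)
    (hc2 : c * c = 1) (hc1 : c ≠ 1) (hcen : ∀ w : G, w * c = c * w) :
    IsLeast {m : ℕ | ∃ S : Finset (CMF G c →₀ ℤ), (↑S ⊆ gfaceSet G c hc2) ∧ S.card = m ∧
      hodgeSpan c hc2 ≤ Submodule.span ℤ (pairSet c) ⊔ Submodule.span ℤ (translates c S)} (fibreTwo c hc2) ∨
    Nonempty (Datum G c) := by
  classical
  haveI : Fact (Nat.Prime 3) := ⟨Nat.prime_three⟩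
  obtain ⟨z, hz⟩ := exists_prime_orderOf_dvd_card 3 (by rw [hG]; norm_num)
  by_cases hzn : ∀ w : G, w * z * w⁻¹ ∈ Subgroup.zpowers z
  · exact Or.inl (isLeast_card_gfaces_generate_fibreTwo_of_card_eq_twentyfour_of_normal c hG z hz hzn hc2 hc1 hcen)
  push Not at hzn
  obtain ⟨P⟩ := (Sylow.nonempty : Nonempty (Sylow 2 G))
  by_cases hcomm : ∀ a ∈ (P : Subgroup G), ∀ b ∈ (P : Subgroup G), a * b = b * a
  · exact Or.inl (isLeast_card_gfaces_generate_fibreTwo_of_card_eq_eight_mul_odd_comm c (m := 3) (by rw [hG]) (by decide)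
      (by norm_num) P hcomm hc2 hc1 hcen)
  · obtain ⟨D, -⟩ := nonempty_datum c hG hz hzn hc2 hc1 hcen P hcomm
    exact Or.inr ⟨D⟩

/-- **THE ORDER-`8p` DICHOTOMY: every finite group of order `8p` (`p` an odd prime) and every central involution `c` has `μ(G, c) = φ₂(G, c)`,
or `p = 3` and `G` carries a binary tetrahedral datum** (part XIV for `p ≥ 5`, the order-24 dichotomy for `p = 3`). [folklore] -/
theorem isLeast_or_nonempty_datum_of_card_eq_eight_mul_prime (c : G) {p : ℕ} (hp : p.Prime) (hp2 : p ≠ 2)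
    (hG : Fintype.card G = 8 * p) (hc2 : c * c = 1) (hc1 : c ≠ 1) (hcen : ∀ w : G, w * c = c * w) :
    IsLeast {m : ℕ | ∃ S : Finset (CMF G c →₀ ℤ), (↑S ⊆ gfaceSet G c hc2) ∧ S.card = m ∧
      hodgeSpan c hc2 ≤ Submodule.span ℤ (pairSet c) ⊔ Submodule.span ℤ (translates c S)} (fibreTwo c hc2) ∨
    (p = 3 ∧ Nonempty (Datum G c)) := by
  by_cases h5 : 5 ≤ p
  · exact Or.inl (isLeast_card_gfaces_generate_fibreTwo_of_card_eq_eight_mul_prime_of_five_le c hp h5 hG hc2 hc1 hcen)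
  · have h2 := hp.two_le
    interval_cases p
    · exact absurd rfl hp2
    · rcases isLeast_or_nonempty_datum_of_card_eq_twentyfour c (by rw [hG]) hc2 hc1 hcen with h | h
      · exact Or.inl h
      · exact Or.inr ⟨rfl, h⟩
    · exact absurd hp (by norm_num)

/-- **ORDER `8p` IN FLOOR CURRENCY**: `μ(G, c) = φ₂(G, c)`, or (`p = 3`, binary tetrahedral) `φ₂(G, c) = β(G, c) − 2` bounds every generating
face family from below — the law is reduced to exhibiting `174` generating faces of `SL(2,3)`. [folklore] -/
theorem isLeast_or_floor_of_card_eq_eight_mul_prime (c : G) {p : ℕ} (hp : p.Prime) (hp2 : p ≠ 2)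
    (hG : Fintype.card G = 8 * p) (hc2 : c * c = 1) (hc1 : c ≠ 1) (hcen : ∀ w : G, w * c = c * w) :
    IsLeast {m : ℕ | ∃ S : Finset (CMF G c →₀ ℤ), (↑S ⊆ gfaceSet G c hc2) ∧ S.card = m ∧
      hodgeSpan c hc2 ≤ Submodule.span ℤ (pairSet c) ⊔ Submodule.span ℤ (translates c S)} (fibreTwo c hc2) ∨
    (p = 3 ∧ fibreTwo c hc2 ∈ lowerBounds {m : ℕ | ∃ S : Finset (CMF G c →₀ ℤ), (↑S ⊆ gfaceSet G c hc2) ∧ S.card = m ∧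
      hodgeSpan c hc2 ≤ Submodule.span ℤ (pairSet c) ⊔ Submodule.span ℤ (translates c S)} ∧
      fibreTwo c hc2 + 2 = Fintype.card (Block c)) := by
  rcases isLeast_or_nonempty_datum_of_card_eq_eight_mul_prime c hp hp2 hG hc2 hc1 hcen with h | ⟨hp3, ⟨D⟩⟩
  · exact Or.inl h
  · exact Or.inr ⟨hp3, D.fibreTwo_mem_lowerBounds⟩

end

end Summit.HodgeConjecture.CorCM.Census.BinaryTetrahedral
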